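import Summits.QuantumFields.YangMills.Theorems.DiagonalMirrorRPR.Negative.PhantomFamily

/-!
# `DiagonalMirrorRPR` — negative lemma: the lattice-convergence clause `hconv` is load-bearing (part 3 of 3)

Supports crux item `stmt-QuantumFields-10604` (`PencilRigidity.DiagonalMirrorRPR` =
`MirrorModularBoosts.DiagonalMirrorRPR`: for every compact simple `G`, `r`, `sch`, `S₁` carrying the curvature
package `W₁` — lattice convergence `hconv` of the renormalised action-density strings on `⁰𝒮`; E0, E0', E2(e₀),
E3, E4; translations and proper signed permutations on `⁰𝒮`; continuum and uniform lattice gap — `S₁` is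
reflection positive in pull-back form for every diagonal frame `R e₀ = (±e₀ ± e₁)/√2`).

**Result.** The implication with `hconv` deleted is FALSE: `phantomFamily` carries every other clause of `W₁`
over the zero scheme, for every `G`, `r` (`phantomFamily_package_without_convergence`, assembling
`PhantomFamily` with `hasLatticeMassGap_of_beta_eq_zero` of `InfiniteCouplingSlice`), and it is NOT reflection
positive in the frame `R e₀ = (e₀ + e₁)/√2` (`exists_diagonalFrame_not_isReflectionPositive_phantomFamily`):
the diagonal frame times `(x⁰ + x¹)/√2` of `Ψ z₀ = ((−1,−1,0,0), (−1,3,0,0), (7,−1,0,0))` are `−2a, 2a, 6a`,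
pairwise distinct although every axis carries a coincidence; placing the E2 terms `−F_A` (a bump, degree 1)
and `F_B` (two bumps, degree 2) there gives `z = −T₃(G_A) − T₃(G_B)` with `Re T₃(G_B) ≥ 0` and
`Re T₃(G_A) ≥ Re I(G_A) > 0`.

**Moral for provers.** Any proof of `DiagonalMirrorRPR` must use `hconv`, in degrees `≥ 3`, on `𝒩`, where no
other clause of `W₁` speaks (with `hconv` the Wilson data pin `S₁` there, so this is no counterexample to the
crux itself).
-/

noncomputable section

open scoped SchwartzMap ComplexConjugate InnerProductSpace
open MeasureTheory Filter Topology Complex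
open Literature.MathematicalPhysics.QuantumLattice Literature.MathematicalPhysics.AQFT
  Literature.MathematicalPhysics.QuantumFieldTheory

namespace Summit.QuantumFields.YangMills.Theorems.DiagonalMirrorRPR.Negative

namespace Phantom

/-! ## The witness test functions -/

section Witness

variable {R : E4 ≃ₗᵢ[ℝ] E4} {a : ℝ}

/-- The target configuration: `x₀ = (−1,−1,0,0)`, `v₀ = (8,4,0,0)`, `z₀ = (x₀, v₀)`,
`Ψ z₀ = (x₀, y₀, w₀)` with `y₀ = (−1,3,0,0)`, `w₀ = (7,−1,0,0)`; frame times `−2a, 2a, 6a`. [folklore] -/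
def x₀ : E4 := -e 0 - e 1
/-- Relative data `v₀ = (8,4,0,0)`. [folklore] -/
def v₀ : E4 := (8 : ℝ) • e 0 + (4 : ℝ) • e 1
/-- The parameter `z₀ = (x₀, v₀)`. [folklore] -/
def z₀ : Z8 := ![x₀, v₀]
/-- Second target point `y₀ = (−1,3,0,0)`. [folklore] -/
def y₀ : E4 := x₀ + proj {1} v₀
/-- Third target point `w₀ = (7,−1,0,0)`. [folklore] -/
def w₀ : E4 := x₀ + proj {0, 2, 3} v₀

/-- `Ψ z₀ = (x₀, y₀, w₀)`. [folklore] -/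
theorem Ψ_z₀ : Ψ z₀ = ![x₀, y₀, w₀] := by
  funext i; fin_cases i <;> rfl

/-- `x₀⁰ = −1`. [folklore] -/
@[simp] theorem x₀_zero : x₀ 0 = -1 := by simp [x₀, e]
/-- `x₀¹ = −1`. [folklore] -/
@[simp] theorem x₀_one : x₀ 1 = -1 := by simp [x₀, e]
/-- `y₀⁰ = −1`. [folklore] -/
@[simp] theorem y₀_zero : y₀ 0 = -1 := by simp [y₀, v₀, e]
/-- `y₀¹ = 3`. [folklore] -/
@[simp] theorem y₀_one : y₀ 1 = 3 := by simp [y₀, v₀, e]; norm_num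
/-- `w₀⁰ = 7`. [folklore] -/
@[simp] theorem w₀_zero : w₀ 0 = 7 := by simp [w₀, v₀, e]; norm_num
/-- `w₀¹ = −1`. [folklore] -/
@[simp] theorem w₀_one : w₀ 1 = -1 := by simp [w₀, v₀, e]

variable (R) (ha : 0 < a)

/-- The bump of radius `a` (plateau `a/2`) at `c`. [folklore] -/
def bump (c : E4) : ContDiffBump c := ⟨a / 2, a, by positivity, by linarith⟩

/-- The bump is `1` at its centre. [folklore] -/
theorem bump_apply_self (c : E4) : (bump ha c) c = 1 :=
  (bump ha c).one_of_mem_closedBall (Metric.mem_closedBall_self (bump ha c).rIn_pos.le)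

/-- The bump vanishes outside the closed ball of radius `a`. [folklore] -/
theorem bump_eq_zero {c x : E4} (hx : x ∉ Metric.closedBall c a) : (bump ha c) x = 0 := by
  apply (bump ha c).zero_of_le_dist
  change a ≤ dist x c
  rw [Metric.mem_closedBall, not_le] at hx
  exact hx.le

/-- Time coordinates in a closed ball of radius `a` are within `a` of the centre's. [folklore] -/
theorem time_ge_of_mem_closedBall {c x : E4} (hx : x ∈ Metric.closedBall c a) : c 0 - a ≤ x 0 ∧ x 0 ≤ c 0 + a := by
  rw [Metric.mem_closedBall, dist_eq_norm] at hx
  have h : |(x - c) 0| ≤ a := le_trans (by simpa using PiLp.norm_apply_le (x - c) 0) hx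
  rw [PiLp.sub_apply, abs_le] at h
  constructor <;> linarith [h.1, h.2]

/-- One-point test function: the bump at `c`, as a complex Schwartz function on `(ℝ⁴)¹`. [folklore] -/
def F₁ (c : E4) : 𝓢((Fin 1 → E4), ℂ) :=
  HasCompactSupport.toSchwartzMap (f := fun p : Fin 1 → E4 => ((bump ha c) (p 0) : ℂ))
    (HasCompactSupport.intro (isCompact_univ_pi fun _ : Fin 1 => isCompact_closedBall c a) fun p hp => by
      simp only [Set.mem_univ_pi, not_forall] at hp
      obtain ⟨i, hi⟩ := hp
      have hi0 : i = 0 := Subsingleton.elim _ _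
      subst hi0
      simp [bump_eq_zero ha hi])
    (Complex.ofRealCLM.contDiff.comp ((bump ha c).contDiff.comp (contDiff_apply ℝ E4 (0 : Fin 1))))

/-- Values of `F₁`. [folklore] -/
@[simp] theorem F₁_apply (c : E4) (p : Fin 1 → E4) : F₁ ha c p = ((bump ha c) (p 0) : ℂ) := rfl

/-- Two-point test function: bumps at `c` and `c'`. [folklore] -/
def F₂ (c c' : E4) : 𝓢((Fin 2 → E4), ℂ) :=
  HasCompactSupport.toSchwartzMap
    (f := fun p : Fin 2 → E4 => (((bump ha c) (p 0) * (bump ha c') (p 1) : ℝ) : ℂ))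
    (HasCompactSupport.intro (isCompact_univ_pi fun i : Fin 2 => isCompact_closedBall (![c, c'] i) a)
      fun p hp => by
        simp only [Set.mem_univ_pi, not_forall] at hp
        obtain ⟨i, hi⟩ := hp
        fin_cases i
        · simp [bump_eq_zero ha (c := c) (by simpa using hi)]
        · simp [bump_eq_zero ha (c := c') (by simpa using hi)])
    (Complex.ofRealCLM.contDiff.comp
      (((bump ha c).contDiff.comp (contDiff_apply ℝ E4 (0 : Fin 2))).mul
        ((bump ha c').contDiff.comp (contDiff_apply ℝ E4 (1 : Fin 2)))))

/-- Values of `F₂`. [folklore] -/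
@[simp] theorem F₂_apply (c c' : E4) (p : Fin 2 → E4) :
    F₂ ha c c' p = (((bump ha c) (p 0) * (bump ha c') (p 1) : ℝ) : ℂ) := rfl

/-- `F₁ c` is time-ordered when the centre sits at time `> a`. [folklore] -/
theorem isTimeOrdered_F₁ {c : E4} (hc : a < c 0) : IsTimeOrdered (F₁ ha c) := by
  have hK : tsupport (F₁ ha c : (Fin 1 → E4) → ℂ) ⊆ {p | p 0 ∈ Metric.closedBall c a} := by
    refine closure_minimal (fun p hp => ?_) (Metric.isClosed_closedBall.preimage (continuous_apply 0))
    by_contra h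
    exact hp (by simp [bump_eq_zero ha h])
  intro p hp
  have h0 := (time_ge_of_mem_closedBall (hK hp)).1
  refine ⟨fun i => ?_, fun i j hij => ?_⟩
  · rw [Subsingleton.elim i 0]; linarith
  · exact absurd hij (by rw [Subsingleton.elim i j]; exact lt_irrefl _)

/-- `F₂ c c'` is time-ordered when the two balls sit at positive, separated, increasing times. [folklore] -/
theorem isTimeOrdered_F₂ {c c' : E4} (hc : a < c 0) (hcc' : c 0 + a < c' 0 - a) : IsTimeOrdered (F₂ ha c c') := by
  have hK : tsupport (F₂ ha c c' : (Fin 2 → E4) → ℂ) ⊆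
      {p | p 0 ∈ Metric.closedBall c a ∧ p 1 ∈ Metric.closedBall c' a} := by
    refine closure_minimal (fun p hp => ?_) ?_
    · constructor
      · by_contra h; exact hp (by simp [bump_eq_zero ha h])
      · by_contra h; exact hp (by simp [bump_eq_zero ha h])
    · have h0c : IsClosed {p : Fin 2 → E4 | p 0 ∈ Metric.closedBall c a} :=
        Metric.isClosed_closedBall.preimage (continuous_apply 0)
      have h1c : IsClosed {p : Fin 2 → E4 | p 1 ∈ Metric.closedBall c' a} :=
        Metric.isClosed_closedBall.preimage (continuous_apply 1)
      exact h0c.inter h1c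
  intro p hp
  obtain ⟨h0, h1⟩ := hK hp
  have t0 := time_ge_of_mem_closedBall h0
  have t1 := time_ge_of_mem_closedBall h1
  refine ⟨fun i => ?_, fun i j hij => ?_⟩
  · fin_cases i
    · show 0 < p 0 0; linarith [t0.1]
    · show 0 < p 1 0; linarith [t1.1]
  · fin_cases i <;> fin_cases j
    · exact absurd hij (lt_irrefl _)
    · show p 0 0 < p 1 0; linarith [t0.2, t1.1]
    · exact absurd hij (by decide)
    · exact absurd hij (lt_irrefl _)

/-- The centres: `c_A = θ R⁻¹ x₀` (time `2a`), `c₀ = R⁻¹ y₀` (time `2a`), `c₁ = R⁻¹ w₀` (time `6a`). [folklore] -/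
def cA : E4 := timeReflection 4 (R.symm x₀)
/-- Centre of the first `F_B` bump: `R⁻¹ y₀`. [folklore] -/
def c₀ : E4 := R.symm y₀
/-- Centre of the second `F_B` bump: `R⁻¹ w₀`. [folklore] -/
def c₁ : E4 := R.symm w₀

variable {R}

/-- `c_A` sits at time `2a`. [folklore] -/
theorem cA_zero (hR : R (e 0) = a • e 0 + a • e 1) : cA R 0 = 2 * a := by
  rw [cA, timeReflection_apply, if_pos rfl, frame_time hR]; simp; ring
/-- `c₀` sits at time `2a`. [folklore] -/
theorem c₀_zero (hR : R (e 0) = a • e 0 + a • e 1) : c₀ R 0 = 2 * a := by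
  rw [c₀, frame_time hR]; simp; ring
/-- `c₁` sits at time `6a`. [folklore] -/
theorem c₁_zero (hR : R (e 0) = a • e 0 + a • e 1) : c₁ R 0 = 6 * a := by
  rw [c₁, frame_time hR]; simp; ring

/-- Pointwise real non-negativity (as complex values). [folklore] -/
def IsRealNonneg {n : ℕ} (G : 𝓢((Fin n → E4), ℂ)) : Prop := ∀ p, 0 ≤ (G p).re ∧ (G p).im = 0

/-- Real non-negativity is preserved by the symmetry actions. [folklore] -/
theorem IsRealNonneg.perm_lin {G : 𝓢((Fin 3 → E4), ℂ)} (hG : IsRealNonneg G) (τ : Equiv.Perm (Fin 3))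
    (L : E4 ≃ₗᵢ[ℝ] E4) : IsRealNonneg (permTest τ (linActMulti L G)) := fun p => by
  rw [permTest_apply, linActMulti_apply]; exact hG _

/-- `Re I(G) ≥ 0` for real non-negative `G`. [folklore] -/
theorem IsRealNonneg.I_re_nonneg {G : 𝓢((Fin 3 → E4), ℂ)} (hG : IsRealNonneg G) : 0 ≤ (I G).re := by
  rw [I_apply]
  have hint : Integrable (fun z : Z8 => G (Ψ z)) :=
    ((SchwartzMap.compCLM ℂ (g := fun z : Z8 => Ψ z) Ψ.hasTemperateGrowth ⟨1, 4, norm_le_Ψ⟩) G).integrable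
  have h := Complex.reCLM.integral_comp_comm hint
  simp only [Complex.reCLM_apply] at h
  rw [← h]
  exact integral_nonneg fun z => (hG _).1

/-- `Re T₃(G) ≥ Re I(G)` for real non-negative `G` (all terms of the average are `≥ 0`; keep the identity term). [folklore] -/
theorem IsRealNonneg.T₃_re_ge {G : 𝓢((Fin 3 → E4), ℂ)} (hG : IsRealNonneg G) : (I G).re ≤ (T₃ G).re := by
  rw [T₃_apply, Complex.re_sum]
  simp_rw [Complex.re_sum]
  have hnn : ∀ g : SignedPerm, ∀ τ : Equiv.Perm (Fin 3), 0 ≤ (I (permTest τ (linActMulti g.1 G))).re :=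
    fun g τ => (hG.perm_lin τ g.1).I_re_nonneg
  calc (I G).re = (I (permTest 1 (linActMulti SignedPerm.one.1 G))).re := by
          rw [show SignedPerm.one.1 = LinearIsometryEquiv.refl ℝ E4 from rfl, linActMulti_refl, permTest_one]
    _ ≤ ∑ τ : Equiv.Perm (Fin 3), (I (permTest τ (linActMulti SignedPerm.one.1 G))).re :=
          Finset.single_le_sum (f := fun τ => (I (permTest τ (linActMulti SignedPerm.one.1 G))).re)
            (fun τ _ => hnn _ τ) (Finset.mem_univ _)
    _ ≤ ∑ g : SignedPerm, ∑ τ : Equiv.Perm (Fin 3), (I (permTest τ (linActMulti g.1 G))).re :=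
          Finset.single_le_sum (f := fun g : SignedPerm => ∑ τ : Equiv.Perm (Fin 3),
              (I (permTest τ (linActMulti g.1 G))).re)
            (fun g _ => Finset.sum_nonneg fun τ _ => hnn g τ) (Finset.mem_univ _)

variable (R)

/-- `G_A = R · (θF_A* ⊗ F_B)`: the degree-`(1,2)` test function of E2 in the diagonal frame. [folklore] -/
def GA : 𝓢((Fin 3 → E4), ℂ) :=
  linActMulti R (SchwartzMap.appendTensor (osAdjoint (F₁ ha (cA R))) (F₂ ha (c₀ R) (c₁ R)))

/-- `G_B = R · (θF_B* ⊗ F_A)`: the degree-`(2,1)` test function. [folklore] -/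
def GB : 𝓢((Fin 3 → E4), ℂ) :=
  linActMulti R (SchwartzMap.appendTensor (osAdjoint (F₂ ha (c₀ R) (c₁ R))) (F₁ ha (cA R)))

/-- Values of `G_A`: a product of three bumps (real, non-negative). [folklore] -/
theorem GA_apply (p : Fin 3 → E4) : GA R ha p =
    (((bump ha (cA R)) (timeReflection 4 (R.symm (p 0))) *
      ((bump ha (c₀ R)) (R.symm (p 1)) * (bump ha (c₁ R)) (R.symm (p 2))) : ℝ) : ℂ) := by
  rw [GA, linActMulti_apply, SchwartzMap.appendTensor_apply, osAdjoint_apply, F₁_apply, F₂_apply]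
  simp only [Function.comp_apply, Complex.conj_ofReal, ← Complex.ofReal_mul]
  rfl

/-- Values of `G_B`. [folklore] -/
theorem GB_apply (p : Fin 3 → E4) : GB R ha p =
    ((((bump ha (c₀ R)) (timeReflection 4 (R.symm (p 1))) * (bump ha (c₁ R)) (timeReflection 4 (R.symm (p 0)))) *
      (bump ha (cA R)) (R.symm (p 2)) : ℝ) : ℂ) := by
  rw [GB, linActMulti_apply, SchwartzMap.appendTensor_apply, osAdjoint_apply, F₁_apply, F₂_apply]
  simp only [Function.comp_apply, Complex.conj_ofReal, ← Complex.ofReal_mul]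
  rfl

/-- `G_A` is real non-negative. [folklore] -/
theorem isRealNonneg_GA : IsRealNonneg (GA R ha) := fun p => by
  rw [GA_apply, Complex.ofReal_re, Complex.ofReal_im]
  exact ⟨mul_nonneg (ContDiffBump.nonneg _) (mul_nonneg (ContDiffBump.nonneg _) (ContDiffBump.nonneg _)), rfl⟩

/-- `G_B` is real non-negative. [folklore] -/
theorem isRealNonneg_GB : IsRealNonneg (GB R ha) := fun p => by
  rw [GB_apply, Complex.ofReal_re, Complex.ofReal_im]
  exact ⟨mul_nonneg (mul_nonneg (ContDiffBump.nonneg _) (ContDiffBump.nonneg _)) (ContDiffBump.nonneg _), rfl⟩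

/-- `G_A(Ψ z₀) = 1`: the carrier subspace `V ⊂ 𝒩` meets the rotated wedge. [folklore] -/
theorem GA_Ψ_z₀ : GA R ha (Ψ z₀) = 1 := by
  rw [GA_apply, Ψ_z₀]
  simp only [Matrix.cons_val_zero, Matrix.cons_val_one, Matrix.cons_val]
  rw [show timeReflection 4 (R.symm x₀) = cA R from rfl, show R.symm y₀ = c₀ R from rfl,
    show R.symm w₀ = c₁ R from rfl, bump_apply_self, bump_apply_self, bump_apply_self]
  simp

/-- `Re I(G_A) > 0`. [folklore] -/
theorem I_GA_re_pos : 0 < (I (GA R ha)).re := by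
  rw [I_apply]
  have hint : Integrable (fun z : Z8 => GA R ha (Ψ z)) :=
    ((SchwartzMap.compCLM ℂ (g := fun z : Z8 => Ψ z) Ψ.hasTemperateGrowth ⟨1, 4, norm_le_Ψ⟩) (GA R ha)).integrable
  have h := Complex.reCLM.integral_comp_comm hint
  simp only [Complex.reCLM_apply] at h
  rw [← h]
  refine integral_pos_of_integrable_nonneg_nonzero (x := z₀) ?_ hint.re (fun z => (isRealNonneg_GA R ha _).1) ?_
  · exact Complex.continuous_re.comp ((GA R ha).continuous.comp Ψ.continuous)
  · simp [GA_Ψ_z₀]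

end Witness

/-- **The diagonal frame sees the phantom**: `phantomFamily` is NOT reflection positive in the frame
`R e₀ = (e₀ + e₁)/√2`. E2 there with the two terms `−F_A` (degree 1) and `F_B` (degree 2) gives
`z = −T₃(G_A) − T₃(G_B)` with `Re T₃(G_B) ≥ 0` and `Re T₃(G_A) ≥ Re I(G_A) > 0`. [folklore] -/
theorem not_isReflectionPositive_pullback_phantomFamily {R : E4 ≃ₗᵢ[ℝ] E4} {a : ℝ} (ha : 0 < a)
    (hR : R (e 0) = a • e 0 + a • e 1) :
    ¬ (SchwingerFamily.toLabelled fun n => (phantomFamily n).comp (linActMulti R)).IsReflectionPositive := by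
  intro hRPR
  -- the two E2 terms
  let deg : Fin 2 → ℕ := ![1, 2]
  let Ft : (j : Fin 2) → 𝓢((Fin (deg j) → E4), ℂ) := fun j =>
    match j with
    | ⟨0, _⟩ => -F₁ ha (cA R)
    | ⟨1, _⟩ => F₂ ha (c₀ R) (c₁ R)
  have hA : IsTimeOrdered (F₁ ha (cA R)) := isTimeOrdered_F₁ ha (by rw [cA_zero hR]; linarith)
  have hB : IsTimeOrdered (F₂ ha (c₀ R) (c₁ R)) :=
    isTimeOrdered_F₂ ha (by rw [c₀_zero hR]; linarith) (by rw [c₀_zero hR, c₁_zero hR]; linarith)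
  have hT : ∀ j, IsTimeOrdered (Ft j) := by
    intro j
    match j with
    | ⟨0, _⟩ =>
      show IsTimeOrdered (-F₁ ha (cA R))
      intro p hp
      apply hA
      have hts : tsupport (⇑(-F₁ ha (cA R))) = tsupport (⇑(F₁ ha (cA R))) := by
        change closure (Function.support (-⇑(F₁ ha (cA R)))) = closure (Function.support ⇑(F₁ ha (cA R)))
        rw [Function.support_neg]
      rwa [hts] at hp
    | ⟨1, _⟩ => exact hB
  have key := hRPR 2 deg (fun _ _ => ()) Ft hT
    (fun i j => SchwartzMap.appendTensor (osAdjoint (Ft i)) (Ft j))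
    (fun i j => isAppendTensorOf_appendTensor _ _)
  obtain ⟨hre, -⟩ := key
  -- expand the `2 × 2` sum
  simp only [Fin.sum_univ_two, SchwingerFamily.toLabelled_apply, ContinuousLinearMap.comp_apply] at hre
  clear hRPR
  have h00 : phantomFamily (deg 0 + deg 0) = 0 := by
    show phantomFamily 2 = 0
    ext G; rw [phantomFamily_apply, vacuumFamily_apply, phantom_of_ne_three (by decide)]; simp
  have h11 : phantomFamily (deg 1 + deg 1) = 0 := by
    show phantomFamily 4 = 0
    ext G; rw [phantomFamily_apply, vacuumFamily_apply, phantom_of_ne_three (by decide)]; simp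
  have h3 : ∀ G, phantomFamily 3 G = T₃ G := fun G => by
    rw [phantomFamily_apply, vacuumFamily_apply, if_neg (by decide), phantom_three, zero_add]
  have h01 : phantomFamily (deg 0 + deg 1) (linActMulti R (SchwartzMap.appendTensor (osAdjoint (Ft 0)) (Ft 1))) =
      -T₃ (GA R ha) := by
    show phantomFamily 3 (linActMulti R (SchwartzMap.appendTensor (osAdjoint (-F₁ ha (cA R))) (F₂ ha (c₀ R) (c₁ R)))) = _
    rw [h3, GA]
    have hneg : ∀ y, (-F₁ ha (cA R)) y = -(F₁ ha (cA R) y) := fun _ => rfl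
    have : SchwartzMap.appendTensor (osAdjoint (-F₁ ha (cA R))) (F₂ ha (c₀ R) (c₁ R)) =
        -SchwartzMap.appendTensor (osAdjoint (F₁ ha (cA R))) (F₂ ha (c₀ R) (c₁ R)) := by
      ext p
      show _ = -(SchwartzMap.appendTensor (osAdjoint (F₁ ha (cA R))) (F₂ ha (c₀ R) (c₁ R)) p)
      simp only [SchwartzMap.appendTensor_apply, osAdjoint_apply, hneg, map_neg, neg_mul]
    rw [this, map_neg, map_neg]
  have h10 : phantomFamily (deg 1 + deg 0) (linActMulti R (SchwartzMap.appendTensor (osAdjoint (Ft 1)) (Ft 0))) =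
      -T₃ (GB R ha) := by
    show phantomFamily 3 (linActMulti R (SchwartzMap.appendTensor (osAdjoint (F₂ ha (c₀ R) (c₁ R))) (-F₁ ha (cA R)))) = _
    rw [h3, GB]
    have hneg : ∀ y, (-F₁ ha (cA R)) y = -(F₁ ha (cA R) y) := fun _ => rfl
    have : SchwartzMap.appendTensor (osAdjoint (F₂ ha (c₀ R) (c₁ R))) (-F₁ ha (cA R)) =
        -SchwartzMap.appendTensor (osAdjoint (F₂ ha (c₀ R) (c₁ R))) (F₁ ha (cA R)) := by
      ext p
      show _ = -(SchwartzMap.appendTensor (osAdjoint (F₂ ha (c₀ R) (c₁ R))) (F₁ ha (cA R)) p)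
      simp only [SchwartzMap.appendTensor_apply, hneg, mul_neg]
    rw [this, map_neg, map_neg]
  rw [h00, h11, h01, h10] at hre
  simp only [zero_apply, zero_add, add_zero, Complex.add_re, Complex.neg_re] at hre
  have hGA : 0 < (T₃ (GA R ha)).re := (I_GA_re_pos R ha).trans_le ((isRealNonneg_GA R ha).T₃_re_ge)
  have hGB : 0 ≤ (T₃ (GB R ha)).re := ((isRealNonneg_GB R ha).I_re_nonneg).trans ((isRealNonneg_GB R ha).T₃_re_ge)
  linarith

/-- **The crux's conclusion fails for the phantom family**: there is a diagonal frame `R e₀ = a e₀ + a e₁`,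
`a² = 1/2`, in which `phantomFamily` is not reflection positive. [folklore] -/
theorem exists_diagonalFrame_not_isReflectionPositive_phantomFamily :
    ∃ (R : E4 ≃ₗᵢ[ℝ] E4) (a b : ℝ), a ^ 2 = 1 / 2 ∧ b ^ 2 = 1 / 2 ∧
      R (EuclideanSpace.single 0 1) = a • EuclideanSpace.single 0 1 + b • EuclideanSpace.single 1 1 ∧
      ¬ (SchwingerFamily.toLabelled fun n => (phantomFamily n).comp (linActMulti R)).IsReflectionPositive := by
  obtain ⟨R, a, ha2, ha, hR⟩ := exists_frame
  exact ⟨R, a, a, ha2, ha2, hR, not_isReflectionPositive_pullback_phantomFamily ha hR⟩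

/-- **`hconv` is load-bearing for `DiagonalMirrorRPR`.** For every compact `G` and every `r`, over the zero
scheme the phantom family carries EVERY clause of the crux's package `W₁` except the lattice-convergence clause
`hconv` — E0, hermiticity, E0', E2(e₀), E3, E4, translation invariance and (all) signed-permutation invariance on
`⁰𝒮`, the continuum gap and the uniform lattice gap (here `Δ = 1`) — while the crux's conclusion fails for it
(`exists_diagonalFrame_not_isReflectionPositive_phantomFamily`). Hence the implication "`W₁` minus `hconv` ⇒
diagonal RP" is false, and any proof of the crux must use `hconv`, in degrees `≥ 3`, on the blind spot `𝒩` of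
the e₀-based axioms. (The conjunction below is `W₁ r (SpeciesScheme.zero _) phantomFamily` with its first
conjunct deleted, verbatim, at `sch = SpeciesScheme.zero (YMSpecies G)`.) [folklore] -/
theorem phantomFamily_package_without_convergence {G : Type} [Group G] [TopologicalSpace G]
    [IsTopologicalGroup G] [CompactSpace G] [MeasurableSpace G] [BorelSpace G] (r : LatticeRep G) :
    (phantomFamily.toLabelled.IsNormalized ∧ phantomFamily.toLabelled.IsHermitian ∧
      phantomFamily.toLabelled.HasLinearGrowth ∧ phantomFamily.toLabelled.IsReflectionPositive ∧
      phantomFamily.toLabelled.IsSymmetric ∧ phantomFamily.toLabelled.HasClusterProperty) ∧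
    (∀ (n : ℕ) (a : E4) (F : 𝓢((Fin n → E4), ℂ)), IsOffDiagonal F →
      phantomFamily n (translateMulti a F) = phantomFamily n F) ∧
    (∀ (R : E4 ≃ₗᵢ[ℝ] E4), LinearMap.det (R.toLinearEquiv : E4 →ₗ[ℝ] E4) = 1 →
      (∀ i : Fin 4, ∃ j : Fin 4, R (EuclideanSpace.single i 1) = EuclideanSpace.single j 1 ∨
        R (EuclideanSpace.single i 1) = -EuclideanSpace.single j 1) →
      ∀ (n : ℕ) (F : 𝓢((Fin n → E4), ℂ)), IsOffDiagonal F → phantomFamily n (linActMulti R F) = phantomFamily n F) ∧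
    (∃ Δ : ℝ, 0 < Δ ∧ phantomFamily.toLabelled.HasMassGap Δ ∧
      HasLatticeMassGap r (SpeciesScheme.zero (YMSpecies G)) Δ) := by
  refine ⟨⟨phantomFamily_isNormalized, phantomFamily_isHermitian, phantomFamily_hasLinearGrowth,
    phantomFamily_isReflectionPositive, phantomFamily_isSymmetric, phantomFamily_hasClusterProperty⟩,
    fun n a F _ => phantomFamily_translateMulti n a F, fun R _ hR n F _ => ?_,
    ⟨1, one_pos, phantomFamily_hasMassGap 1, hasLatticeMassGap_of_beta_eq_zero r _ (fun _ => rfl) 1⟩⟩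
  exact phantomFamily_linActMulti ⟨R, hR⟩ n F

end Phantom

end Summit.QuantumFields.YangMills.Theorems.DiagonalMirrorRPR.Negative
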